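import Summits.BirchSwinnertonDyer.BirchSwinnertonDyer.Theorems.PrintCf2ParityCrossingResidual
import Mathlib.NumberTheory.LegendreSymbol.JacobiSymbol
import HarnessLib

set_option linter.dupNamespace false -- `…BirchSwinnertonDyer.BirchSwinnertonDyer…` is the cell's namespace (D-0017)
set_option autoImplicit false

/-!
# Crux `PrintCf2.SplitBadTwoRankOneOfFacts` (item 20368), line `parity-crossing-two` — part VI: the EXPONENT of the level-49
# residual made explicit: `e(dδ) = e(d) + ι(δ) + 2σ(δ)` for `(d, δ) = 1`, and `ι(δ)` is ODD when `7` splits in `K″ = ℚ(√δ)`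

Cell `bsd-print-cf2`, seat `bsd-line-cf2-p1-w2` (prover, width seat on crux stmt-BirchSwinnertonDyer-20368, line `parity_crossing_two`).
`--supports stmt-BirchSwinnertonDyer-20368` (helper). Theses-free; theorems only; no `sorry`, no definition, no new named fact.
HONEST FRAMING: elementary bookkeeping (prime factors of a coprime product; multiplicativity of the Legendre symbol at `7`) that
makes the right-hand side of part II's `bsdp_two_iff_heegnerHeight_of_partner` — `(1+e(d)) + (1+e(dδ)) + s′ + s₁` with the cell's
`e(n) = ι(n) + 2σ(n)` (`ι`/`σ` = number of odd prime factors `ℓ` of `n` with `(ℓ/7) = −1` / `≠ −1`) — explicit in `d` and `δ`: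
**`2 + 2ι(d) + 4σ(d) + ι(δ) + 2σ(δ) + ord₂#Ш(W′)[2^∞] + ord₂#Ш(W₁)[2^∞]`**, with `ι(δ)` ODD (since `δ < 0` and `(δ/7) = +1` force
`(|δ|/7) = −1`). Nothing is proved about the research identity, the crux or BSD; no summit statement is proved by this seat.

* §1 `card_filter_erase_primeFactors_mul` — prime-factor counts of a coprime product add.
* §2 `odd_card_filter_jacobiSym_eq_neg_one` — for `δ < 0` squarefree, `7 ∤ δ`, `(δ/7) = 1`: `ι(δ)` is odd.
* §3 `card_exponent_pair_eq` — the exponent of the pair in `(d, δ)`-separated form (the two `Finset` cardinalities of part II at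
  `d·δ` rewritten), for `δ` odd with `(d, δ) = 1`.

References: R. L. Miller, LMS JCM 14 (2011) Def. 1.1 [Miller2011LMS]; J. H. Silverman, *Advanced Topics* (1994) IV.9 Table 4.1
[Silverman1994] (the Tamagawa exponents `ι + 2σ` of the cell); K. Ireland, M. Rosen, *A Classical Introduction* (1990) Prop. 5.1.2
(multiplicativity of the Legendre symbol) [IrelandRosen1990].
-/

noncomputable section

open scoped Classical

namespace Summit.BirchSwinnertonDyer.BirchSwinnertonDyer.Theorems.PrintCf2

/-! ## §1 Prime-factor counts of a coprime product -/

/-- For coprime `a, b`: the number of prime factors `≠ 2` of `a·b` satisfying `p` is the sum of those of `a` and of `b`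
(`(ab).primeFactors = a.primeFactors ⊔ b.primeFactors`, disjointly). [folklore] -/
theorem card_filter_erase_primeFactors_mul {a b : ℕ} (hab : Nat.Coprime a b) (p : ℕ → Prop) [DecidablePred p] :
    (((a * b).primeFactors.erase 2).filter p).card =
      ((a.primeFactors.erase 2).filter p).card + ((b.primeFactors.erase 2).filter p).card := by
  rw [Nat.Coprime.primeFactors_mul hab, Finset.erase_union_distrib, Finset.filter_union,
    Finset.card_union_of_disjoint]
  exact (Nat.Coprime.disjoint_primeFactors hab).mono
    ((Finset.filter_subset _ _).trans (Finset.erase_subset _ _))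
    ((Finset.filter_subset _ _).trans (Finset.erase_subset _ _))

/-- The same for integers `d, δ` with `gcd(d, δ) = 1`, through `|dδ| = |d|·|δ|`. [folklore] -/
theorem card_filter_erase_primeFactors_natAbs_mul {d δ : ℤ} (hcop : Int.gcd d δ = 1) (p : ℕ → Prop) [DecidablePred p] :
    ((((d * δ).natAbs).primeFactors.erase 2).filter p).card =
      ((d.natAbs.primeFactors.erase 2).filter p).card + ((δ.natAbs.primeFactors.erase 2).filter p).card := by
  rw [Int.natAbs_mul]
  exact card_filter_erase_primeFactors_mul (by simpa [Int.gcd] using hcop) p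

/-- For ODD `δ` the `erase 2` is idle on `|δ|.primeFactors`. [folklore] -/
theorem erase_two_primeFactors_natAbs_of_odd {δ : ℤ} (hδ : Odd δ) :
    δ.natAbs.primeFactors.erase 2 = δ.natAbs.primeFactors := by
  rw [Finset.erase_eq_self]
  intro h
  have h2 : 2 ∣ δ.natAbs := Nat.dvd_of_mem_primeFactors h
  have h2' : (2 : ℤ) ∣ δ := Int.ofNat_dvd_left.mpr h2
  obtain ⟨k, hk⟩ := hδ
  omega

/-! ## §2 `ι(δ)` is odd when `δ < 0` and `7` splits in `ℚ(√δ)` -/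

/-- A product of signs `±1` over a finset is `(−1)^{#\{sign = −1\}}`. [folklore] -/
theorem prod_eq_neg_one_pow_card_filter {S : Finset ℕ} {f : ℕ → ℤ} (hf : ∀ p ∈ S, f p = 1 ∨ f p = -1) :
    ∏ p ∈ S, f p = (-1) ^ (S.filter (fun p ↦ f p = -1)).card := by
  induction S using Finset.induction_on with
  | empty => simp
  | insert a S ha ih =>
    rw [Finset.prod_insert ha, Finset.filter_insert, ih (fun p hp ↦ hf p (Finset.mem_insert_of_mem hp))]
    rcases hf a (Finset.mem_insert_self a S) with h1 | h1
    · rw [h1, if_neg (by norm_num), one_mul]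
    · rw [h1, if_pos rfl, Finset.card_insert_of_notMem (fun h ↦ ha (Finset.mem_of_mem_filter a h)), pow_succ]
      ring

/-- **`ι(δ)` is ODD**: for `δ < 0` squarefree with `7 ∤ δ` and `(δ/7) = +1` (i.e. `7` split in `ℚ(√δ)`), the number of prime factors
`ℓ` of `|δ|` with `(ℓ/7) = −1` is odd — `(|δ|/7) = (−1/7)(δ/7) = −1` and the Legendre symbol at `7` is multiplicative over the
(squarefree) prime factorisation of `|δ|`. [cite: IrelandRosen1990, Prop. 5.1.2 (multiplicativity of the Legendre symbol)] -/
theorem odd_card_filter_jacobiSym_eq_neg_one {δ : ℤ} (hδ : δ < 0) (hsq : Squarefree δ) (h7 : ¬ (7 : ℤ) ∣ δ)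
    (hj : jacobiSym δ 7 = 1) :
    Odd ((δ.natAbs.primeFactors.filter (fun l : ℕ ↦ jacobiSym l 7 = -1)).card) := by
  haveI : Fact (Nat.Prime 7) := ⟨by norm_num⟩
  set n : ℕ := δ.natAbs with hn
  have hδn : δ = -(n : ℤ) := by rw [hn, Int.natCast_natAbs, abs_of_neg hδ, neg_neg]
  have hsqn : Squarefree n := Int.squarefree_natAbs.mpr hsq
  -- `(n/7) = −1`
  have hn7 : jacobiSym (n : ℤ) 7 = -1 := by
    have h := hj
    rw [hδn, jacobiSym.neg _ (by decide : Odd 7), ZMod.χ₄_nat_three_mod_four (by norm_num : 7 % 4 = 3)] at h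
    linarith
  -- multiplicativity over the prime factorisation of the squarefree `n`
  have hprod : (n : ℤ) = ∏ p ∈ n.primeFactors, (p : ℤ) := by
    rw [← Nat.cast_prod, Nat.prod_primeFactors_of_squarefree hsqn]
  have hmul : jacobiSym (n : ℤ) 7 = ∏ p ∈ n.primeFactors, jacobiSym (p : ℤ) 7 := by
    rw [hprod, ← jacobiSym.legendreSym.to_jacobiSym]
    rw [show legendreSym 7 (∏ p ∈ n.primeFactors, (p : ℤ)) = legendreSym.hom 7 (∏ p ∈ n.primeFactors, (p : ℤ)) from rfl,
      map_prod]
    refine Finset.prod_congr rfl fun p _ ↦ ?_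
    rw [legendreSym.hom_apply, jacobiSym.legendreSym.to_jacobiSym]
  -- each factor is `±1` (`p ≠ 7` prime)
  have hsign : ∀ p ∈ n.primeFactors, jacobiSym (p : ℤ) 7 = 1 ∨ jacobiSym (p : ℤ) 7 = -1 := by
    intro p hp
    apply jacobiSym.eq_one_or_neg_one
    have hpp : p.Prime := Nat.prime_of_mem_primeFactors hp
    have hp7 : p ≠ 7 := by
      rintro rfl
      exact h7 (Int.ofNat_dvd_left.mpr (Nat.dvd_of_mem_primeFactors hp))
    have : Nat.Coprime p 7 := (Nat.coprime_primes hpp (by norm_num)).mpr hp7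
    simpa [Int.gcd] using this
  rw [hmul, prod_eq_neg_one_pow_card_filter hsign] at hn7
  -- `(−1)^k = −1` forces `k` odd
  rcases Nat.even_or_odd ((n.primeFactors.filter (fun p : ℕ ↦ jacobiSym (p : ℤ) 7 = -1)).card) with hev | hodd
  · rw [hev.neg_one_pow] at hn7; norm_num at hn7
  · exact hodd

/-! ## §3 The exponent of the pair, separated in `d` and `δ` -/

/-- **The exponent of part II in `(d, δ)`-separated form.** For `gcd(d, δ) = 1` and `δ` odd:
`(1 + ι(d) + 2σ(d)) + (1 + ι(dδ) + 2σ(dδ)) = 2 + 2ι(d) + 4σ(d) + ι(δ) + 2σ(δ)`, where on the left `ι(dδ), σ(dδ)` are the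
`Finset` cardinalities of `bsdp_two_iff_heegnerHeight_of_partner` at `d·δ` and on the right `ι(δ), σ(δ)` count ALL prime factors of
`|δ|` (no `erase 2`, `δ` being odd). With §2, the right-hand side of the level-49 residual is
`2 + 2ι(d) + 4σ(d) + ι(δ) + 2σ(δ) + ord₂#Ш(W′)[2^∞] + ord₂#Ш(W₁)[2^∞]` with `ι(δ)` odd. [cite: Miller2011LMS, Def. 1.1]
[cite: Silverman1994, IV.9 Table 4.1] -/
theorem card_exponent_pair_eq {d δ : ℤ} (hcop : Int.gcd d δ = 1) (hδ : Odd δ) :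
    ((1 + ((d.natAbs.primeFactors.erase 2).filter (fun l : ℕ => jacobiSym l 7 = -1)).card +
          2 * ((d.natAbs.primeFactors.erase 2).filter (fun l : ℕ => ¬ jacobiSym l 7 = -1)).card : ℕ) : ℤ) +
      ((1 + (((d * δ).natAbs.primeFactors.erase 2).filter (fun l : ℕ => jacobiSym l 7 = -1)).card +
          2 * (((d * δ).natAbs.primeFactors.erase 2).filter (fun l : ℕ => ¬ jacobiSym l 7 = -1)).card : ℕ) : ℤ) =
      2 + 2 * (((d.natAbs.primeFactors.erase 2).filter (fun l : ℕ => jacobiSym l 7 = -1)).card : ℤ) +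
        4 * (((d.natAbs.primeFactors.erase 2).filter (fun l : ℕ => ¬ jacobiSym l 7 = -1)).card : ℤ) +
        ((δ.natAbs.primeFactors.filter (fun l : ℕ => jacobiSym l 7 = -1)).card : ℤ) +
        2 * ((δ.natAbs.primeFactors.filter (fun l : ℕ => ¬ jacobiSym l 7 = -1)).card : ℤ) := by
  rw [card_filter_erase_primeFactors_natAbs_mul hcop, card_filter_erase_primeFactors_natAbs_mul hcop,
    erase_two_primeFactors_natAbs_of_odd hδ]
  push_cast
  ring

end Summit.BirchSwinnertonDyer.BirchSwinnertonDyer.Theorems.PrintCf2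

end
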